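import Mathlib
import Literature.MathematicalPhysics.StatisticalMechanics.HaggStacking

/-!
# Route `MinMeanCycleStackingLock`, item stmt-AtomisticToContinuum-12024 `LockedPhaseDefectBound` —
# part 1/3: certificate cycles

Helper file (lands `--supports stmt-AtomisticToContinuum-12024`) for the quantitative Peierls
estimate `LockedPhaseDefectBound`.  Contents:

* `exists_cycle_corrector` — for an injective self-map `σ` of a finite type and a bounded `F`,
  a `σ`-invariant `τ` (orbit averages) and a bounded corrector `v` with `F = τ + v − v ∘ σ`
  (the cohomological equation on the cycles of a permutation);
* `exists_successor`, `letter_eq_iterate`, `window_eq_iterate`, `haggWindow_eq_orbit_sum` — the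
  de Bruijn successor structure of a certificate set `E` of `(L+1)`-windows with injective
  prefixes/suffixes and continuation: consecutive `E`-windows of a sequence follow the successor
  map, so window sums along a followed stretch are read off the `σ`-orbit;
* summability bookkeeping for couplings with `Σ k|J_k| < ∞`, the range splitting
  `haggLocalEnergy = haggLocalEnergyTrunc (L+1) + tail`, and the identification of the
  certificate's window sums / local slack energy with `haggWindow` / `haggLocalEnergyTrunc`.

All statements are elementary ([folklore]); no new definitions.
-/

namespace Summit.AtomisticToContinuum.Crystallization.Theorems

open Finset Filter Literature.MathematicalPhysics.StatisticalMechanics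
open scoped Topology

namespace LockedPhaseDefect

/-- Every point of a finite type is periodic under an injective self-map, with minimal period in
`[1, card α]`. -/
theorem minimalPeriod_pos_and_le_card {α : Type*} [Fintype α] (σ : α → α)
    (hσ : Function.Injective σ) (x : α) :
    0 < Function.minimalPeriod σ x ∧ Function.minimalPeriod σ x ≤ Fintype.card α := by
  classical
  obtain ⟨a, b, hab, h⟩ := Fintype.exists_ne_map_eq_of_card_lt
    (fun i : Fin (Fintype.card α + 1) => σ^[i] x) (by simp)
  -- wlog a < b
  wlog hlt : (a : ℕ) < b generalizing a b
  · exact this b a hab.symm h.symm (lt_of_le_of_ne (not_lt.mp hlt) (fun e => hab (Fin.ext e).symm))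
  have hp : Function.IsPeriodicPt σ (b - a) x := by
    unfold Function.IsPeriodicPt Function.IsFixedPt
    apply hσ.iterate a
    rw [← Function.iterate_add_apply, Nat.add_sub_cancel' hlt.le]
    exact h.symm
  have hn : 0 < (b : ℕ) - a := Nat.sub_pos_of_lt hlt
  refine ⟨hp.minimalPeriod_pos hn, (hp.minimalPeriod_le hn).trans ?_⟩
  have := b.isLt
  omega

/-- Every point of a finite type is a periodic point of an injective self-map. -/
theorem mem_periodicPts_of_injective {α : Type*} [Fintype α] (σ : α → α)
    (hσ : Function.Injective σ) (x : α) : x ∈ Function.periodicPts σ :=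
  Function.mk_mem_periodicPts (minimalPeriod_pos_and_le_card σ hσ x).1
    (Function.isPeriodicPt_minimalPeriod σ x)

/-- Shifting the base point of an orbit sum by one step of `σ`. -/
theorem sum_range_iterate_apply {α : Type*} (σ : α → α) (F : α → ℝ) (x : α) (i : ℕ) :
    ∑ l ∈ range i, F (σ^[l] (σ x)) = ∑ l ∈ range (i + 1), F (σ^[l] x) - F x := by
  rw [Finset.sum_range_succ']
  simp [Function.iterate_succ_apply]

/-- **Cycle corrector.** For an injective self-map `σ` of a finite type and a bounded function `F`,
there are a `σ`-invariant function `τ` (the orbit averages of `F`) and a bounded corrector `v` with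
`F = τ + v - v ∘ σ`. -/
theorem exists_cycle_corrector {α : Type*} [Fintype α] (σ : α → α) (hσ : Function.Injective σ)
    (F : α → ℝ) (t : ℝ) (hF : ∀ x, |F x| ≤ t) :
    ∃ τ v : α → ℝ, (∀ x, F x = τ x + v x - v (σ x)) ∧ (∀ x, τ (σ x) = τ x) ∧
      (∀ x, |τ x| ≤ t) ∧ (∀ x, |v x| ≤ Fintype.card α * t) := by
  classical
  set p : α → ℕ := fun x => Function.minimalPeriod σ x with hp_def
  have hp : ∀ x, 0 < p x ∧ p x ≤ Fintype.card α := fun x => minimalPeriod_pos_and_le_card σ hσ x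
  have hpσ : ∀ x, p (σ x) = p x := fun x =>
    Function.minimalPeriod_apply (mem_periodicPts_of_injective σ hσ x)
  have hfix : ∀ x, σ^[p x] x = x := fun x => Function.iterate_minimalPeriod
  refine ⟨fun x => (∑ i ∈ range (p x), F (σ^[i] x)) / p x,
    fun x => (∑ i ∈ range (p x), ∑ l ∈ range i, F (σ^[l] x)) / p x, ?_, ?_, ?_, ?_⟩
  · -- the cohomological identity
    intro x
    have hpx : (0 : ℝ) < p x := by exact_mod_cast (hp x).1
    dsimp only
    rw [hpσ x]
    simp only [sum_range_iterate_apply]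
    rw [eq_comm, ← sub_eq_zero]
    have : ∑ i ∈ range (p x), (∑ l ∈ range (i + 1), F (σ^[l] x) - F x)
        = ∑ i ∈ range (p x), ∑ l ∈ range i, F (σ^[l] x) + ∑ i ∈ range (p x), F (σ^[i] x)
          - p x * F x := by
      rw [Finset.sum_sub_distrib, Finset.sum_const, card_range, nsmul_eq_mul, ← Finset.sum_add_distrib]
      congr 1
      exact Finset.sum_congr rfl fun i _ => Finset.sum_range_succ _ _
    rw [this]
    field_simp
    ring
  · -- σ-invariance of the orbit average
    intro x
    dsimp only
    rw [hpσ x]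
    congr 1
    rw [sum_range_iterate_apply, Finset.sum_range_succ, hfix x]
    ring
  · -- |τ| ≤ t
    intro x
    have hpx : (0 : ℝ) < p x := by exact_mod_cast (hp x).1
    rw [abs_div, abs_of_pos hpx, div_le_iff₀ hpx]
    calc |∑ i ∈ range (p x), F (σ^[i] x)| ≤ ∑ i ∈ range (p x), |F (σ^[i] x)| :=
          abs_sum_le_sum_abs _ _
      _ ≤ ∑ _i ∈ range (p x), t := sum_le_sum fun i _ => hF _
      _ = t * p x := by rw [sum_const, card_range, nsmul_eq_mul, mul_comm]
  · -- |v| ≤ card α * t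
    intro x
    have hpx : (0 : ℝ) < p x := by exact_mod_cast (hp x).1
    have ht : 0 ≤ t := (abs_nonneg _).trans (hF x)
    rw [abs_div, abs_of_pos hpx, div_le_iff₀ hpx]
    calc |∑ i ∈ range (p x), ∑ l ∈ range i, F (σ^[l] x)|
        ≤ ∑ i ∈ range (p x), |∑ l ∈ range i, F (σ^[l] x)| := abs_sum_le_sum_abs _ _
      _ ≤ ∑ i ∈ range (p x), ∑ l ∈ range i, |F (σ^[l] x)| :=
          sum_le_sum fun i _ => abs_sum_le_sum_abs _ _
      _ ≤ ∑ i ∈ range (p x), ∑ _l ∈ range i, t :=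
          sum_le_sum fun i _ => sum_le_sum fun l _ => hF _
      _ ≤ ∑ _i ∈ range (p x), (p x : ℝ) * t := by
          refine sum_le_sum fun i hi => ?_
          rw [sum_const, card_range, nsmul_eq_mul]
          have : (i : ℝ) ≤ p x := by exact_mod_cast (mem_range.mp hi).le
          exact mul_le_mul_of_nonneg_right this ht
      _ = (p x : ℝ) * (p x * t) := by rw [sum_const, card_range, nsmul_eq_mul]
      _ ≤ Fintype.card α * t * p x := by
          rw [mul_comm, mul_assoc]
          have : (p x : ℝ) ≤ Fintype.card α := by exact_mod_cast (hp x).2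
          nlinarith [mul_le_mul_of_nonneg_right this (mul_nonneg ht hpx.le)]

/-- **Successor map.** If prefixes and suffixes are injective on `E` and every suffix of an
`E`-word is the prefix of an `E`-word, then `E` carries an injective successor map `σ` with
`prefix (σ x) = suffix x`. -/
theorem exists_successor {L : ℕ} (E : Finset (Fin (L + 1) → ℤ))
    (hsuf : ∀ x ∈ E, ∀ y ∈ E, (fun i : Fin L => x (Fin.succ i)) =
      (fun i : Fin L => y (Fin.succ i)) → x = y)
    (hcont : ∀ x ∈ E, ∃ y ∈ E, (fun i : Fin L => y (Fin.castSucc i)) =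
      (fun i : Fin L => x (Fin.succ i))) :
    ∃ σ : E → E, Function.Injective σ ∧
      ∀ (x : E) (i : Fin L), (σ x).1 (Fin.castSucc i) = x.1 (Fin.succ i) := by
  choose f hfE hf using hcont
  refine ⟨fun x => ⟨f x.1 x.2, hfE x.1 x.2⟩, ?_, ?_⟩
  · intro x y hxy
    have h1 : f x.1 x.2 = f y.1 y.2 := congrArg Subtype.val hxy
    have h2 : (fun i : Fin L => x.1 (Fin.succ i)) = (fun i : Fin L => y.1 (Fin.succ i)) := by
      rw [← hf x.1 x.2, ← hf y.1 y.2, h1]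
    exact Subtype.ext (hsuf x.1 x.2 y.1 y.2 h2)
  · intro x i
    exact congrFun (hf x.1 x.2) i

/-- **Letters along the successor orbit.** The `n`-th letter of `x` is the first letter of
`σ^[n] x`. -/
theorem letter_eq_iterate {L : ℕ} {E : Finset (Fin (L + 1) → ℤ)} (σ : E → E)
    (hσ : ∀ (x : E) (i : Fin L), (σ x).1 (Fin.castSucc i) = x.1 (Fin.succ i)) :
    ∀ (n : ℕ) (x : E) (h : n < L + 1), x.1 ⟨n, h⟩ = (σ^[n] x).1 0 := by
  intro n
  induction n with
  | zero => intro x h; rfl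
  | succ n ih =>
    intro x h
    have h1 : x.1 ⟨n + 1, h⟩ = (σ x).1 ⟨n, by omega⟩ := by
      have := hσ x ⟨n, by omega⟩
      simpa [Fin.succ_mk, Fin.castSucc_mk] using this.symm
    rw [h1, ih (σ x) (by omega), Function.iterate_succ_apply]

/-- **Following the certificate.** If the windows of `s` at positions `m, m+1, …, m+d` all lie in
`E`, then they are the successive `σ`-iterates of the window at `m` (prefix-uniqueness). -/
theorem window_eq_iterate {L : ℕ} {E : Finset (Fin (L + 1) → ℤ)} (σ : E → E)
    (hσ : ∀ (x : E) (i : Fin L), (σ x).1 (Fin.castSucc i) = x.1 (Fin.succ i))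
    (hpre : ∀ x ∈ E, ∀ y ∈ E, (fun i : Fin L => x (Fin.castSucc i)) =
      (fun i : Fin L => y (Fin.castSucc i)) → x = y)
    (s : ℤ → ℤ) (m : ℤ) (d : ℕ) (x : E) (hx : x.1 = fun i : Fin (L + 1) => s (m + i))
    (hgood : ∀ j : ℕ, j ≤ d → (fun i : Fin (L + 1) => s (m + j + i)) ∈ E) :
    ∀ j : ℕ, j ≤ d → (fun i : Fin (L + 1) => s (m + j + i)) = (σ^[j] x).1 := by
  intro j
  induction j with
  | zero => intro _; simp [hx]
  | succ j ih =>
    intro hj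
    have hj' : j ≤ d := by omega
    have hprev := ih hj'
    rw [Function.iterate_succ_apply']
    apply hpre _ (hgood (j + 1) hj) _ (σ (σ^[j] x)).2
    funext i
    rw [hσ (σ^[j] x) i, ← hprev]
    simp only [Fin.val_castSucc, Fin.val_succ]
    push_cast
    ring_nf

/-- **Window sums along a followed stretch.** Under the hypotheses of `window_eq_iterate`, the
window sums of `s` at `m` of every length `k ≤ d + L + 1` are read off the `σ`-orbit of the window
at `m`. -/
theorem haggWindow_eq_orbit_sum {L : ℕ} {E : Finset (Fin (L + 1) → ℤ)} (σ : E → E)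
    (hσ : ∀ (x : E) (i : Fin L), (σ x).1 (Fin.castSucc i) = x.1 (Fin.succ i))
    (hpre : ∀ x ∈ E, ∀ y ∈ E, (fun i : Fin L => x (Fin.castSucc i)) =
      (fun i : Fin L => y (Fin.castSucc i)) → x = y)
    (s : ℤ → ℤ) (m : ℤ) (d : ℕ) (x : E) (hx : x.1 = fun i : Fin (L + 1) => s (m + i))
    (hgood : ∀ j : ℕ, j ≤ d → (fun i : Fin (L + 1) => s (m + j + i)) ∈ E)
    (k : ℕ) (hk : k ≤ d + L + 1) :
    haggWindow s m k = ∑ t ∈ range k, (σ^[t] x).1 0 := by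
  unfold haggWindow
  refine sum_congr rfl fun t ht => ?_
  have htk : t < k := mem_range.mp ht
  -- split t = j + i with j ≤ d and i ≤ L
  set j := min t d with hj
  have hjd : j ≤ d := min_le_right _ _
  have hjt : j ≤ t := min_le_left _ _
  have hi : t - j < L + 1 := by omega
  have hw := window_eq_iterate σ hσ hpre s m d x hx hgood j hjd
  have h1 : s (m + t) = (fun i : Fin (L + 1) => s (m + j + i)) ⟨t - j, hi⟩ := by
    simp only
    congr 1
    omega
  rw [h1, hw, letter_eq_iterate σ hσ (t - j) (σ^[j] x) hi, ← Function.iterate_add_apply,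
    Nat.sub_add_cancel hjt]

/-! ## Summability bookkeeping -/

/-- `Σ k|J_k| < ∞` implies `Σ |J_k| < ∞`. -/
theorem summable_abs_of_summable_mul_abs {J : ℕ → ℝ}
    (hJ : Summable fun k : ℕ => (k : ℝ) * |J k|) : Summable fun k => |J k| := by
  have h1 : Summable fun k : ℕ => (((k + 1 : ℕ) : ℝ)) * |J (k + 1)| :=
    (summable_nat_add_iff (f := fun k : ℕ => (k : ℝ) * |J k|) 1).mpr hJ
  have h2 : Summable fun k : ℕ => |J (k + 1)| := by
    refine Summable.of_nonneg_of_le (fun k => abs_nonneg _) (fun k => ?_) h1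
    have : (1 : ℝ) ≤ ((k + 1 : ℕ) : ℝ) := by exact_mod_cast Nat.succ_pos k
    nlinarith [abs_nonneg (J (k + 1))]
  exact (summable_nat_add_iff (f := fun k : ℕ => |J k|) 1).mp h2

/-- An indicator-weighted coupling sequence is summable. -/
theorem summable_ite_of_summable_abs {J : ℕ → ℝ} (hJ : Summable fun k => |J k|) (P : ℕ → Prop)
    [DecidablePred P] : Summable fun k => if P k then J k else 0 := by
  refine Summable.of_norm_bounded hJ fun k => ?_
  split_ifs <;> simp

/-- An indicator-weighted absolute coupling sequence is summable. -/
theorem summable_ite_abs_of_summable_abs {J : ℕ → ℝ} (hJ : Summable fun k => |J k|) (P : ℕ → Prop)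
    [DecidablePred P] : Summable fun k => if P k then |J k| else 0 := by
  refine Summable.of_norm_bounded hJ fun k => ?_
  split_ifs <;> simp

/-- An indicator-weighted `k|J_k|` sequence is summable. -/
theorem summable_ite_mul_abs {J : ℕ → ℝ} (hJ : Summable fun k : ℕ => (k : ℝ) * |J k|)
    (P : ℕ → Prop) [DecidablePred P] : Summable fun k => if P k then (k : ℝ) * |J k| else 0 := by
  refine Summable.of_norm_bounded hJ fun k => ?_
  have : 0 ≤ (k : ℝ) * |J k| := mul_nonneg (Nat.cast_nonneg k) (abs_nonneg _)
  split_ifs <;> simp [this]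

/-- **Range splitting of the local energy**: all ranges = ranges `≤ L+1` plus the tail beyond
`L+1`. -/
theorem haggLocalEnergy_eq_trunc_add_tail {J : ℕ → ℝ} (hJ : Summable fun k => |J k|) (L : ℕ)
    (s : ℤ → ℤ) (m : ℤ) :
    haggLocalEnergy J s m = haggLocalEnergyTrunc (L + 1) J s m +
      ∑' k : ℕ, if L + 1 < k ∧ HaggAligned s m k then J k else 0 := by
  unfold haggLocalEnergy haggLocalEnergyTrunc
  have hsplit : ∀ k : ℕ, (if 2 ≤ k ∧ HaggAligned s m k then J k else 0) =
      (if k ∈ Icc 2 (L + 1) ∧ HaggAligned s m k then J k else 0) +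
      (if L + 1 < k ∧ HaggAligned s m k then J k else 0) := by
    intro k
    by_cases hal : HaggAligned s m k
    · by_cases h2 : 2 ≤ k
      · by_cases hL : L + 1 < k
        · rw [if_pos ⟨h2, hal⟩, if_neg (fun h => ?_), if_pos ⟨hL, hal⟩, zero_add]
          have := (mem_Icc.mp h.1).2; omega
        · rw [if_pos ⟨h2, hal⟩, if_pos ⟨mem_Icc.mpr ⟨h2, not_lt.mp hL⟩, hal⟩,
            if_neg (fun h => hL h.1), add_zero]
      · have hL : ¬ L + 1 < k := by omega
        rw [if_neg (fun h => h2 h.1), if_neg (fun h => h2 (mem_Icc.mp h.1).1),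
          if_neg (fun h => hL h.1), add_zero]
    · rw [if_neg (fun h => hal h.2), if_neg (fun h => hal h.2), if_neg (fun h => hal h.2), add_zero]
  rw [tsum_congr hsplit, Summable.tsum_add (summable_ite_of_summable_abs hJ _)
    (summable_ite_of_summable_abs hJ _), tsum_eq_sum (s := Icc 2 (L + 1))]
  · congr 1
    refine sum_congr rfl fun k hk => ?_
    by_cases hal : HaggAligned s m k
    · rw [if_pos ⟨hk, hal⟩, if_pos hal]
    · rw [if_neg (fun h => hal h.2), if_neg hal]
  · intro k hk
    rw [if_neg (fun h => hk h.1)]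

/-- The tail local energy is bounded from below by minus the tail mass
`t₀ = Σ_{k > L+1} |J_k|`. -/
theorem neg_tail_le {J : ℕ → ℝ} (hJ : Summable fun k => |J k|) (L : ℕ) (s : ℤ → ℤ) (m : ℤ) :
    -(∑' k : ℕ, if L + 1 < k then |J k| else 0) ≤
      ∑' k : ℕ, if L + 1 < k ∧ HaggAligned s m k then J k else 0 := by
  rw [← tsum_neg]
  refine Summable.tsum_le_tsum (fun k => ?_) (summable_ite_abs_of_summable_abs hJ _).neg
    (summable_ite_of_summable_abs hJ _)
  by_cases hL : L + 1 < k
  · by_cases hal : HaggAligned s m k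
    · rw [if_pos hL, if_pos ⟨hL, hal⟩]; exact neg_abs_le _
    · rw [if_pos hL, if_neg (fun h => hal h.2)]; simp
  · rw [if_neg hL, if_neg (fun h => hL h.1)]; simp

/-- The full local energy is bounded from below by `-Σ |J_k|`. -/
theorem neg_tsum_abs_le_haggLocalEnergy {J : ℕ → ℝ} (hJ : Summable fun k => |J k|) (s : ℤ → ℤ)
    (m : ℤ) : -(∑' k : ℕ, |J k|) ≤ haggLocalEnergy J s m := by
  unfold haggLocalEnergy
  rw [← tsum_neg]
  refine Summable.tsum_le_tsum (fun k => ?_) hJ.neg (summable_ite_of_summable_abs hJ _)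
  split_ifs
  · exact neg_abs_le _
  · simp

/-! ## The finite-range part: telescoping the node potentials -/

/-- The certificate's window sum is the Hägg window sum. -/
theorem fin_sum_ite_lt_eq_haggWindow {L : ℕ} (s : ℤ → ℤ) (m : ℤ) {k : ℕ} (hk : k ≤ L + 1) :
    (∑ i : Fin (L + 1), if (i : ℕ) < k then s (m + ((i : ℕ) : ℤ)) else 0) = haggWindow s m k := by
  rw [Fin.sum_univ_eq_sum_range (fun i => if i < k then s (m + (i : ℤ)) else 0) (L + 1),
    ← sum_filter, haggWindow]
  congr 1
  ext i
  simp only [mem_filter, mem_range]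
  omega

/-- The certificate's local slack energy of the window of `s` at `m` is the truncated local
energy `haggLocalEnergyTrunc (L+1) J s m`. -/
theorem cert_energy_eq_haggLocalEnergyTrunc (J : ℕ → ℝ) (L : ℕ) (s : ℤ → ℤ) (m : ℤ) :
    (∑ k ∈ Icc 2 (L + 1), if (∑ i : Fin (L + 1), if (i : ℕ) < k then s (m + ((i : ℕ) : ℤ)) else 0)
      % 3 = 0 then J k else 0) = haggLocalEnergyTrunc (L + 1) J s m := by
  unfold haggLocalEnergyTrunc HaggAligned
  refine sum_congr rfl fun k hk => ?_
  rw [fin_sum_ite_lt_eq_haggWindow s m (mem_Icc.mp hk).2]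

/-- Prefixes of windows of a Hägg sequence are `±1`-words. -/
theorem prefix_mem_piFinset {L : ℕ} (s : ℤ → ℤ) (hs : IsHaggSeq s) (m : ℤ) :
    (fun i : Fin L => s (m + ((i : ℕ) : ℤ))) ∈
      Fintype.piFinset (fun _ : Fin L => ({1, -1} : Finset ℤ)) := by
  refine Fintype.mem_piFinset.mpr fun i => ?_
  rcases hs (m + ((i : ℕ) : ℤ)) with h | h <;> simp [h]

/-- A value of `u` at a `±1`-word is bounded by the total `Σ_y |u y|` over `±1`-words. -/
theorem abs_apply_le_sum_abs {L : ℕ} (u : (Fin L → ℤ) → ℝ) {y : Fin L → ℤ}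
    (hy : y ∈ Fintype.piFinset (fun _ : Fin L => ({1, -1} : Finset ℤ))) :
    |u y| ≤ ∑ z ∈ Fintype.piFinset (fun _ : Fin L => ({1, -1} : Finset ℤ)), |u z| :=
  single_le_sum (f := fun z => |u z|) (fun z _ => abs_nonneg (u z)) hy

end LockedPhaseDefect

end Summit.AtomisticToContinuum.Crystallization.Theorems
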